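import Summits.QuantumFields.BalabanUV.Beta.GAN24.DerivativeRateTransferJensenHolonomy

/-!
# `BalabanUV.Beta.GAN24.DerivativeRateTransferJensenLadder` — binder row G-an2-4 ∕ (CONV-C), route R6 «VALUES, NOT DERIVATIVES», PART 27:
# THE LADDER LEMMA (non-abelian lattice Stokes by induction) — the holonomy of a LADDER loop «bottom path of `m` bonds, last rung, top path back,
# first rung back» is within `m·κ` of `1` when each of its `m` plaquettes (bottom bond, rung, top bond back, rung back) is within `κ`; nested twice
# this is the `κ ≤ |C|·L·κ_p` feed of PART 22's block loops (unit b2b-balaban-gan24-p3, gen 37; v1)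

NOT IN PRINT; OUR PROOF (for the ROUTE; [folklore] — `loop_{m+1} = (a₀·loop′·a₀ᵀ)·(a₀r₁b₀ᵀr₀ᵀ)` for orthogonal factors, then PART 25's `defect_conj` ∕
`defect_mul` BY NAME; no surface ordering subtlety because only a BOUND is proved — idea-1 g38's located shape (3)).  HONEST FRAMING (cell contract,
verbatim): «discharging `BetaPertH` makes Bałaban's UV stability UNCONDITIONAL — a real constructive-QFT result; it is NOT the continuum limit and NOT the
Clay problem.»  HONEST DEPENDENCY (verbatim): «continuum YM on T⁴ ⇐ BetaPertH ∧ nine spine estimates (0/9 proved); BetaPertH ⇐ (D1) ∧ (D4) ∧ CAP+tail;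
G-an2-4 gates asym, D1 and NE2/3/4.»

WHY THIS FILE.  PART 25 bounds the defect of a loop ALREADY WRITTEN as a product of lassos; the block loop of PART 22 ∕ 24 («contour `x → base(y)`,
translated contour back, joined by two straight `μ`-lines of `L` bonds») is a LADDER whose rungs are the contour bonds' `1 × L` rectangles, and each
rectangle is itself a ladder of `L` plaquettes.  THIS FILE proves the ladder bound abstractly (transports as DATA: bottom bonds `a_i`, top bonds `b_i`,
rungs `r_i`, all orthogonal `o × o` matrices), so that the consumer who DEFINES Bałaban's block transporters `W` and coarse transporters `R′` as path
products gets `κ_j ≤ |C|·L·κ_p^{(j+1)}` (`|C| ≤ d·(L−1)` contour bonds) from two applications — the `K ≤ cK·τ²` input of PART 23 §1 once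
`κ_p^{(j+1)} = O(η_{j+1}²)` (small fields).

WHAT THIS FILE PROVES (0 sorry, 0 `def`, nothing cited):
* `orthogonal_cancel` (`XᵀX = 1 ⟹ Xᵀ(XY) = Y`), `orthogonal_prod_ofFn`, `orthogonal_ladder` (the ladder holonomy is orthogonal).
* **`ladder_succ`** — the peeling identity `Π(a)·r_last·Π(b)ᵀ·r₀ᵀ = (a₀·[ladder of the shifted data]·a₀ᵀ)·(a₀·r₁·b₀ᵀ·r₀ᵀ)`.
* **`defect_ladder`** — bottom `a : Fin m → M`, top `b : Fin m → M`, rungs `r : Fin (m+1) → M` orthogonal; every plaquette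
  `a_i·r_{i+1}·b_iᵀ·r_iᵀ` within `κ` ⟹ the ladder holonomy `Π_i a_i · r_m · (Π_i b_i)ᵀ · r_0ᵀ` is within `m·κ`.
WHAT IT DOES NOT DO: define Bałaban's contours ∕ transporters or identify the block loop with a nested ladder (the consumer's definitions); bound `κ_p`.
SUPPLIER work on route R6 (rank 2, REDUCTION, no seat); no consumer of record; NEVER «G-an2-4 closed»; NOT (CONV-C), NOT D1, NOT `BetaPertH`, NOT
continuum, NOT Clay.  Records: `HOME/b2b-balaban-gan24-p3/WOODBURY-FIBRE.md` v13.7.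
-/

noncomputable section

open Matrix

namespace Summit.QuantumFields.BalabanUV.Beta.GAN24.DerivativeRateTransferJensenLadder

open Summit.QuantumFields.BalabanUV.Beta.GAN24.DerivativeRateTransferJensenChain
open Summit.QuantumFields.BalabanUV.Beta.GAN24.DerivativeRateTransferJensenHolonomy

variable {o : Type*} [Fintype o] [DecidableEq o]

/-! ## §1 Orthogonality bookkeeping -/

section Orth

omit [DecidableEq o] in
/-- `XᵀX = 1 ⟹ Xᵀ(XY) = Y`. [folklore] -/
theorem orthogonal_cancel [DecidableEq o] {X : Matrix o o ℝ} (hX : Xᵀ * X = 1) (Y : Matrix o o ℝ) : Xᵀ * (X * Y) = Y := by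
  rw [← Matrix.mul_assoc, hX, Matrix.one_mul]

/-- an `ofFn` product of orthogonal matrices is orthogonal. [folklore] -/
theorem orthogonal_prod_ofFn {m : ℕ} (a : Fin m → Matrix o o ℝ) (h : ∀ i, (a i)ᵀ * a i = 1) :
    ((List.ofFn a).prod)ᵀ * (List.ofFn a).prod = 1 :=
  orthogonal_listProd _ fun X hX => by
    obtain ⟨i, rfl⟩ := List.mem_ofFn.mp hX
    exact h i

/-- the ladder holonomy is orthogonal. [folklore] -/
theorem orthogonal_ladder {m : ℕ} (a b : Fin m → Matrix o o ℝ) (r : Fin (m + 1) → Matrix o o ℝ)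
    (ha : ∀ i, (a i)ᵀ * a i = 1) (hb : ∀ i, (b i)ᵀ * b i = 1) (hr : ∀ i, (r i)ᵀ * r i = 1) :
    ((List.ofFn a).prod * r (Fin.last m) * ((List.ofFn b).prod)ᵀ * (r 0)ᵀ)ᵀ *
      ((List.ofFn a).prod * r (Fin.last m) * ((List.ofFn b).prod)ᵀ * (r 0)ᵀ) = 1 :=
  orthogonal_mul (orthogonal_mul (orthogonal_mul (orthogonal_prod_ofFn a ha) (hr _))
    (transpose_orthogonal (orthogonal_prod_ofFn b hb))) (transpose_orthogonal (hr 0))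

end Orth

/-! ## §2 The peeling identity and the ladder bound -/

section Ladder

/-- **`ladder_succ` — PEELING THE FIRST PLAQUETTE**: for orthogonal `a₀` and `r₁`,
`Π_{i≤m} a_i · r_{m+1} · (Π_{i≤m} b_i)ᵀ · r₀ᵀ = (a₀ · [Π_{1≤i≤m} a_i · r_{m+1} · (Π_{1≤i≤m} b_i)ᵀ · r₁ᵀ] · a₀ᵀ) · (a₀ · r₁ · b₀ᵀ · r₀ᵀ)`. [folklore] -/
theorem ladder_succ {m : ℕ} (a b : Fin (m + 1) → Matrix o o ℝ) (r : Fin (m + 2) → Matrix o o ℝ)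
    (ha0 : (a 0)ᵀ * a 0 = 1) (hr1 : (r 1)ᵀ * r 1 = 1) :
    (List.ofFn a).prod * r (Fin.last (m + 1)) * ((List.ofFn b).prod)ᵀ * (r 0)ᵀ =
      (a 0 * ((List.ofFn fun i : Fin m => a i.succ).prod * r (Fin.last m).succ * ((List.ofFn fun i : Fin m => b i.succ).prod)ᵀ * (r 1)ᵀ)
          * (a 0)ᵀ) *
        (a 0 * r 1 * (b 0)ᵀ * (r 0)ᵀ) := by
  rw [List.ofFn_succ, List.prod_cons, List.ofFn_succ, List.prod_cons, transpose_mul, Fin.succ_last]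
  simp only [Matrix.mul_assoc]
  rw [orthogonal_cancel ha0, orthogonal_cancel hr1]

/-- **`defect_ladder` — THE LADDER LEMMA** [our proof]: bottom bonds `a_i`, top bonds `b_i` (`i < m`), rungs `r_i` (`i ≤ m`), all orthogonal; every
plaquette holonomy `a_i·r_{i+1}·b_iᵀ·r_iᵀ` within `κ ≥ 0` of `1` ⟹ the ladder holonomy `Π_i a_i · r_m · (Π_i b_i)ᵀ · r_0ᵀ` is within `m·κ` of `1`. -/
theorem defect_ladder : ∀ (m : ℕ) (a b : Fin m → Matrix o o ℝ) (r : Fin (m + 1) → Matrix o o ℝ) (κ : ℝ), 0 ≤ κ →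
    (∀ i, (a i)ᵀ * a i = 1) → (∀ i, (b i)ᵀ * b i = 1) → (∀ i, (r i)ᵀ * r i = 1) →
    (∀ (i : Fin m) (w : o → ℝ),
      ((a i * r i.succ * (b i)ᵀ * (r i.castSucc)ᵀ - 1) *ᵥ w) ⬝ᵥ ((a i * r i.succ * (b i)ᵀ * (r i.castSucc)ᵀ - 1) *ᵥ w) ≤ κ ^ 2 * (w ⬝ᵥ w)) →
    ∀ w : o → ℝ,
      (((List.ofFn a).prod * r (Fin.last m) * ((List.ofFn b).prod)ᵀ * (r 0)ᵀ - 1) *ᵥ w) ⬝ᵥ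
          (((List.ofFn a).prod * r (Fin.last m) * ((List.ofFn b).prod)ᵀ * (r 0)ᵀ - 1) *ᵥ w) ≤ (m * κ) ^ 2 * (w ⬝ᵥ w)
  | 0, a, b, r, κ, _, _, _, hr, _ => by
    intro w
    have e : (List.ofFn a).prod * r (Fin.last 0) * ((List.ofFn b).prod)ᵀ * (r 0)ᵀ = 1 := by
      rw [List.ofFn_zero, List.ofFn_zero, List.prod_nil, Matrix.one_mul, transpose_one, Matrix.mul_one, Fin.last_zero,
        mul_transpose_of_orthogonal (hr 0)]
    rw [e]
    simp
  | m + 1, a, b, r, κ, hκ, ha, hb, hr, hp => by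
    intro w
    -- the shifted ladder
    have ih := defect_ladder m (fun i => a i.succ) (fun i => b i.succ) (fun i => r i.succ) κ hκ (fun i => ha _) (fun i => hb _)
      (fun i => hr _) (fun i w' => by simpa only [Fin.succ_castSucc] using hp i.succ w')
    rw [ladder_succ a b r (ha 0) (hr 1)]
    have horth' := orthogonal_ladder (fun i : Fin m => a i.succ) (fun i => b i.succ) (fun i => r i.succ) (fun i => ha _) (fun i => hb _)
      (fun i => hr _)
    have horth : (a 0 * ((List.ofFn fun i : Fin m => a i.succ).prod * r (Fin.last m).succ *
        ((List.ofFn fun i : Fin m => b i.succ).prod)ᵀ * (r 1)ᵀ) * (a 0)ᵀ)ᵀ *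
        (a 0 * ((List.ofFn fun i : Fin m => a i.succ).prod * r (Fin.last m).succ *
          ((List.ofFn fun i : Fin m => b i.succ).prod)ᵀ * (r 1)ᵀ) * (a 0)ᵀ) = 1 :=
      orthogonal_mul (orthogonal_mul (ha 0) horth') (transpose_orthogonal (ha 0))
    have h1 := defect_conj (ha 0) ih
    have h2 : ∀ w : o → ℝ, ((a 0 * r 1 * (b 0)ᵀ * (r 0)ᵀ - 1) *ᵥ w) ⬝ᵥ ((a 0 * r 1 * (b 0)ᵀ * (r 0)ᵀ - 1) *ᵥ w) ≤ κ ^ 2 * (w ⬝ᵥ w) :=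
      fun w' => by simpa only [Fin.succ_zero_eq_one, Fin.castSucc_zero] using hp 0 w'
    refine (defect_mul horth (mul_nonneg (Nat.cast_nonneg _) hκ) hκ h1 h2 w).trans (le_of_eq ?_)
    push_cast; ring

end Ladder

end Summit.QuantumFields.BalabanUV.Beta.GAN24.DerivativeRateTransferJensenLadder

end
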